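import Summits.CriticalPhenomena.PercolationContinuityZ3.Theorems.PercNearOneGluingNoHeavyQuantReplicateBinomial
import HarnessLib

/-!
# QUANT lane R8, T-DEC: THE TILT FORMULA ASSEMBLED — at the canonical weight the residual of `k` identical siblings is
# `R_a = [(1−a)(1−(1−q)^{k−1})·δ₀ + Σ_{n=1}^{k} a·C(k,n)qⁿ(1−q)^{k−n}·(1 − (a·rfac)^{n−1})·ρ^{∗n}] / (1 − rfac^{k−1})`
# (k-general, any sub-forest law; arm-1 gen 49, architect)

builds on p205010 (kernel theorem, internal audit signed; external expert review pending)

Support file (`--supports stmt-CriticalPhenomena-4575`), QUANT lane seat prim-quant-arm-1 (gen 49, architect), rung R8 of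
`run/shared/lean/prim/quant/LADDER.md`; memo `run/shared/lean/prim/quant/prim-quant-arm-1-g49/ARCH-G49.md` §8.  Theorems only, standard axioms, no sorries;
the one-step assembly of `…QuantReplicateBinomial` (`resid_replicate_binomial` at `w = wco = rfac^{k−1}`, `wco_replicate`, `tilt_coeff`, `tilt_coeff_zero`).

THE FORMULA (`resid_replicate_tilt`).  For a law-OK sibling `t = gate ρ q`, `0 < a ≤ 1`, `k ≥ 1` and every `h`:
  `resid a (wco a (replicate k t)) (replicate k t) h
     = ( (1−a)(1 − (1−q)^{k−1})·δ₀ h + Σ_{n < k} a·C(k,n+1)·q^{n+1}(1−q)^{k−n−1}·(1 − (a·rfac a t)^n)·cpow M ρ (n+1) h ) / (1 − rfac a t ^ (k−1))`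
— the residual of README V428's expansion for identical siblings is the forest's own binomial mixture over the number `n+1 ≥ 1` of reached roots, TILTED toward
many roots by the concave factor `1 − (a·rfac)^{n}` (zero on singletons), plus an explicit atom at `0`; valid for ANY sub-forest law `ρ` and every width.  With
`cpow_laws` (atoms of `ρ^{∗n}`) this is the k-general input to the certificate criteria of `…QuantBudgetFlow` / `…QuantLowCeiling` / `…QuantHalfTop`.

* `cpow_zero_apply`; **`resid_replicate_tilt`**.

HONEST STATUS: a bookkeeping identity; `ResidDEC`, `SiblingStep`, `GateStepN`, `FarTreeRow` OPEN; RATE class log\* / honest sentence of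
`run/shared/lean/prim/quant/README.md` unchanged.  [this work].  Nothing here is cited as a published result.  The gluing rows served
[cite: KozmaNitzan2024, Conjecture 3 (p. 15)]; product measure [cite: Grimmett1999, §1.3 p. 10].
-/

noncomputable section

open scoped BigOperators

namespace Summit.CriticalPhenomena.PercolationContinuityZ3.Theorems
namespace Quant
namespace LawDec

open Finset

/-- `ρ^{∗0}` pointwise. [this work] -/
theorem cpow_zero_apply (M : ℕ) (ρ : ℕ → ℝ) (h : ℕ) : cpow M ρ 0 h = if h = 0 then (1 : ℝ) else 0 := rfl

/-- **THE TILT FORMULA** (identical siblings, canonical weight, `k ≥ 1`, `0 < a ≤ 1`): see the module docstring. [this work] -/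
theorem resid_replicate_tilt (t : Sib) (ht : t.LawOK) {a : ℝ} (ha0 : 0 < a) (ha1 : a ≤ 1) {k : ℕ} (hk : 1 ≤ k) (h : ℕ) :
    resid a (wco a (List.replicate k t)) (List.replicate k t) h =
      ((1 - a) * (1 - (1 - t.q) ^ (k - 1)) * (if h = 0 then (1 : ℝ) else 0) +
        ∑ n ∈ Finset.range k,
          (a * (((Nat.choose k (n + 1) : ℕ) : ℝ) * t.q ^ (n + 1) * (1 - t.q) ^ (k - (n + 1))) * (1 - (a * rfac a t) ^ n)) *
            cpow t.M t.ρ (n + 1) h) / (1 - rfac a t ^ (k - 1)) := by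
  rw [wco_replicate a t k hk, resid_replicate_binomial t ht ha0 ha1 _ k h]
  congr 1
  rw [Finset.sum_range_succ']
  have hterm : ∀ n ∈ Finset.range k,
      (a * (((Nat.choose k (n + 1) : ℕ) : ℝ) * t.q ^ (n + 1) * (1 - t.q) ^ (k - (n + 1))) -
          rfac a t ^ (k - 1) * (((Nat.choose k (n + 1) : ℕ) : ℝ) * (a * t.q) ^ (n + 1) * (1 - a * t.q) ^ (k - (n + 1)))) *
        cpow t.M t.ρ (n + 1) h
        = (a * (((Nat.choose k (n + 1) : ℕ) : ℝ) * t.q ^ (n + 1) * (1 - t.q) ^ (k - (n + 1))) * (1 - (a * rfac a t) ^ n)) *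
            cpow t.M t.ρ (n + 1) h := by
    intro n hn
    have hnk : n + 1 ≤ k := by rw [Finset.mem_range] at hn; omega
    rw [tilt_coeff ha1 t ht (by omega) hnk, Nat.add_sub_cancel]
  rw [Finset.sum_congr rfl hterm, cpow_zero_apply, ← tilt_coeff_zero ha1 t ht hk]
  ring


end LawDec
end Quant
end Summit.CriticalPhenomena.PercolationContinuityZ3.Theorems
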